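import Summits.QuantumFields.YangMills.Theorems.PoincareLipschitzHierAlignT3SharpData
import Summits.QuantumFields.YangMills.Theorems.PoincareLipschitzHierAlignSharpStep
import HarnessLib

/-!
# Crux stmt-QuantumFields-19936 `HistoryTailL` — S-ALIGN (S2): THE HIERARCHICAL GAUGE WITH GEOMETRIC DECAY `(2∕L)^{·}` BELOW THE TOP
# `dist1 (((Ū^i U)^{u_i}) c) ≤ 72L²·Σ_{i≤i'<j+1} θBal(K−i')·(2∕L)^{i'−i} + 3347L³·θBal(K−j)·(2∕L)^{j+1−i}` on the level-`i` region, `i ≤ j`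

Cell `ym3-torus` (rung R3 = YM₃ on T³ — a RUNG, NOT the Clay problem), width seat `ym-ust-19936-w3` gen 12, `--supports stmt-QuantumFields-19936 --as helper`.
Summons w2 g11 02:42:44Z «w3 g12: S-ALIGN … `Theorems/PoincareLipschitzHierAlignT3Sharp.lean` … with a UNIFORM ratio r < 1» (any fixed `r < 1` serves
✓`PoincareLipschitzMassRowsOfLowCharts`; here `r = 2∕L ≤ 2∕3`).  The FLAT tower ✓`PoincareLipschitzHierAlignT3Level` (each coarse deviation sits on
one fine link: `B_i = B_{i+1} + 50L²θ_i`) is replaced, below its two top levels, by the SHARP step ✓`PoincareLipschitzHierAlignSharpStep`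
(`B_i ≤ B_{i+1}∕L + 3840(B_{i+1}+w)² + 15w + 44L²θ_i`, `w = 4θ_{i+1}` from the `3`-cube axial gauges of the coarse plaquettes), whose quadratic
term is absorbed under `θBal ≤ 1∕(2·10⁷L⁴)` (✓`…T3SharpLetters.sharp_smallness`, `arith_level`): `B_i ≤ (2∕L)B_{i+1} + 72L²θ_i`.
THIS FILE: `exists_hierGauge_sharp_aux` (downward induction from the flat level `j`, regions `5L^{j+1} + 12(L^i − 1)`, data
✓`…T3SharpData.coarse_data ∕ fine_plaq_data`) and ★★★ `exists_hierGauge_dist1_le_of_windows_level_sharp` (all `i ≤ j`; level `j+1` is the flat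
top of ✓T3Level; hStab's windows VERBATIM; extra hypothesis `0 ≤ p₀`).
-/


noncomputable section

open scoped BigOperators

namespace Summit.QuantumFields.YangMills.Theorems.PoincareLipschitzHierAlignT3Sharp

open Literature.MathematicalPhysics.QuantumFieldTheory.Balaban1983to89
open Literature.MathematicalPhysics.QuantumFieldTheory.Balaban1983to89.T3ContinuumYM3Torus
open Literature.MathematicalPhysics.QuantumFieldTheory.Balaban1983to89.T3UnitLawDensityEML
open T4Continuum BlockAveraging ExpMeanLog T3UnitScaleTilt
open Literature.MathematicalPhysics.QuantumFieldTheory.Balaban1983to89.B3Taylor310LocalRemainder (tdist_triangle tdist_comm tdist_self)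
open Summit.QuantumFields.YangMills.Theorems.PoincareLipschitzHierAlignT3Geometry
open Summit.QuantumFields.YangMills.Theorems.PoincareLipschitzHierAlignTower (dist1_relGauge_le)
open Summit.QuantumFields.YangMills.Theorems.PoincareLipschitzHierAlignT3 (twentytwo_lt_sitesPerDir_succ guard_lt_deltaSU)
open Summit.QuantumFields.YangMills.Theorems.PoincareLipschitzHierAlignT3Level (exists_hierGauge_dist1_le_of_windows_level)
open Summit.QuantumFields.YangMills.Theorems.PoincareLipschitzHierAlignSharpStep (exists_smoothGauge)
open T4AxialGaugeSmallField (castSite castSite_apply boxPlaqs axialGauge dist1_gaugeAct_axialGauge_le_uniform)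
open B7Prop1Explicit (e e_apply)

open Summit.QuantumFields.YangMills.Theorems.PoincareLipschitzHierAlignT3SharpLetters
open Summit.QuantumFields.YangMills.Theorems.PoincareLipschitzHierAlignT3SharpData

variable {F : T3Family} {K j : ℕ} {γ b₀ p₀ : ℝ}

/-! ## §3 The sharp tower -/

/-- ★★ **THE ROOTED SHARP STEP AT THE CRUX'S WINDOWS** (`i < j`): given ANY gauge `h'` of `T^{(i+1)}` carrying the sharp chart `β_{i+1}` on the
level-`(i+1)` region, a gauge `u` of `T^{(i)}` ROOTED in it (`u ∘ emb = h'`) carries `β_i = 72L²θ_i + (2∕L)β_{i+1}` on the level-`i` region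
(✓`PoincareLipschitzHierAlignSharpStep.exists_smoothGauge` with ✓`…T3SharpData`, absorbed by ✓`…T3SharpLetters.arith_level`). [folklore] -/
theorem exists_rooted_sharp_step (hjK : j + 3 ≤ K) (hγ : 0 < γ) (hγ1 : γ ≤ 1) (hb : 0 < b₀) (hp : 0 ≤ p₀)
    (hθσ : ∀ i, i ≤ j → θBal F.L γ b₀ p₀ (K - i) ≤ 1 / (2 * 10 ^ 7 * (F.L : ℝ) ^ 4))
    (a : Plaq (F.P K) (j + 1)) (U : GaugeField (F.P K) 0 (Matrix.specialUnitaryGroup (Fin 2) ℂ))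
    (hU : (∀ (i : ℕ) (q : Plaq (F.P K) i), i < j + 1 → Site.tdist (fun k => ((((q.src k).val * F.L ^ i : ℕ)) : ZMod ((F.P K).sitesPerDir 0))) (fun k => ((((a.src k).val * F.L ^ (j + 1) : ℕ)) : ZMod ((F.P K).sitesPerDir 0))) + 64 * F.L ^ i ≤ 64 * F.L ^ (j + 1) → GaugeGroup.dist1 (GaugeField.plaqHol (Averaging.iter (fun i' => BlockAveraging.blockAvg (P := F.P K) (j := i') T3UnitLawDensityEML.ℰp) i U) q) < T3UnitScaleTilt.θBal F.L γ b₀ p₀ (K - i))) {i : ℕ} (hij : i < j)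
    (h' : GaugeTransf (F.P K) (i + 1) (Matrix.specialUnitaryGroup (Fin 2) ℂ))
    (hh' : ∀ c : PBond (F.P K) (i + 1),
      Site.tdist (fun k => ((((c.src k).val * F.L ^ (i + 1) : ℕ)) : ZMod ((F.P K).sitesPerDir 0)))
          (fun k => ((((a.src k).val * F.L ^ (j + 1) : ℕ)) : ZMod ((F.P K).sitesPerDir 0))) ≤ 5 * F.L ^ (j + 1) + 12 * (F.L ^ (i + 1) - 1) →
      dist1 (GaugeField.gaugeAct h' (Averaging.iter (fun i' => BlockAveraging.blockAvg (P := F.P K) (j := i') T3UnitLawDensityEML.ℰp) (i + 1) U) c) ≤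
        72 * (F.L : ℝ) ^ 2 * (∑ i' ∈ Finset.Ico (i + 1) j, θBal F.L γ b₀ p₀ (K - i') * ((2 : ℝ) / F.L) ^ (i' - (i + 1))) +
          6694 * (F.L : ℝ) ^ 2 * θBal F.L γ b₀ p₀ (K - j) * ((2 : ℝ) / F.L) ^ (j - (i + 1))) :
    ∃ u : GaugeTransf (F.P K) i (Matrix.specialUnitaryGroup (Fin 2) ℂ), (∀ y, u (emb y) = h' y) ∧ ∀ c : PBond (F.P K) i,
      Site.tdist (fun k => ((((c.src k).val * F.L ^ i : ℕ)) : ZMod ((F.P K).sitesPerDir 0)))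
          (fun k => ((((a.src k).val * F.L ^ (j + 1) : ℕ)) : ZMod ((F.P K).sitesPerDir 0))) ≤ 5 * F.L ^ (j + 1) + 12 * (F.L ^ i - 1) →
      dist1 (GaugeField.gaugeAct u (Averaging.iter (fun i' => BlockAveraging.blockAvg (P := F.P K) (j := i') T3UnitLawDensityEML.ℰp) i U) c) ≤
        72 * (F.L : ℝ) ^ 2 * (∑ i' ∈ Finset.Ico i j, θBal F.L γ b₀ p₀ (K - i') * ((2 : ℝ) / F.L) ^ (i' - i)) +
          6694 * (F.L : ℝ) ^ 2 * θBal F.L γ b₀ p₀ (K - j) * ((2 : ℝ) / F.L) ^ (j - i) := by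
  have hL3 : 3 ≤ F.L := (by obtain ⟨k, hk⟩ := F.hL.1; have := F.hL.2; omega)
  have hL1 : 1 ≤ F.L := by omega
  have hLr : (3 : ℝ) ≤ F.L := by exact_mod_cast hL3
  have hm := F.hm
  have hd : (F.P K).d = 3 := rfl
  have hθ0 : ∀ i, 0 ≤ θBal F.L γ b₀ p₀ (K - i) := fun i =>
    (T3MinimiserStabilityReduction.θBal_pos (by omega) hγ hγ1 hb p₀ (K - i)).le
  have hσ75 : ∀ i, i ≤ j → θBal F.L γ b₀ p₀ (K - i) ≤ 1 / (75 * ((F.L : ℝ) + 1) ^ 2) := fun i hi => (hθσ i hi).trans (by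
    rw [div_le_div_iff₀ (by positivity) (by positivity), one_mul, one_mul]
    have hL2 : (9 : ℝ) ≤ (F.L : ℝ) ^ 2 := by nlinarith
    have h1 : ((F.L : ℝ) + 1) ^ 2 ≤ 4 * (F.L : ℝ) ^ 2 := by nlinarith
    have h4 : (F.L : ℝ) ^ 4 = (F.L : ℝ) ^ 2 * (F.L : ℝ) ^ 2 := by ring
    nlinarith)
  have hi1 : i + 1 ≤ (F.P K).m + (F.P K).K := by show i + 1 ≤ F.m + K; omega
  set θi : ℝ := θBal F.L γ b₀ p₀ (K - i) with hθi
  set X : ℝ := 72 * (F.L : ℝ) ^ 2 * (∑ i' ∈ Finset.Ico (i + 1) j, θBal F.L γ b₀ p₀ (K - i') * ((2 : ℝ) / F.L) ^ (i' - (i + 1))) +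
    6694 * (F.L : ℝ) ^ 2 * θBal F.L γ b₀ p₀ (K - j) * ((2 : ℝ) / F.L) ^ (j - (i + 1)) with hX
  set w : ℝ := 4 * θBal F.L γ b₀ p₀ (K - (i + 1)) with hw
  obtain ⟨hX0, hw0, hsmall, hq⟩ := sharp_smallness (F := F) (K := K) hγ hγ1 hb hθσ hij
  set V : GaugeField (F.P K) i (Matrix.specialUnitaryGroup (Fin 2) ℂ) :=
    Averaging.iter (fun i' => BlockAveraging.blockAvg (P := F.P K) (j := i') T3UnitLawDensityEML.ℰp) i U with hV
  have hcoarse := coarse_data hjK hγ hγ1 hb a U hU hij h' hh'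
  have hplaq := fine_plaq_data (γ := γ) (b₀ := b₀) (p₀ := p₀) hjK a U hU hij
  have hcard : Fintype.card (Fin 2) ≤ 9 := by rw [Fintype.card_fin]; norm_num
  have hsmall' : 8 * (((F.P K).d : ℝ) + 1) * (X + w) ≤ 1 / 10 := by rw [hd]; push_cast; exact hsmall
  have hguard : (((((F.P K).d + 2) * (F.P K).L : ℕ) : ℝ) ^ 2 / 4) * θi < deltaSU (Fin 2) := guard_lt_deltaSU (hσ75 i hij.le)
  obtain ⟨u, huroot, hu⟩ := exists_smoothGauge (n := Fin 2) hcard hi1 (show 3 ≤ (F.P K).L from hL3) V h' _ _ hX0 hw0 (hθ0 i) hsmall'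
    hguard hcoarse hplaq
  refine ⟨u, huroot, fun c hc => ?_⟩
  have hcS : blockOf c.src ∈ {s : Site (F.P K) (i + 1) | Site.tdist (fun k => ((((s k).val * F.L ^ (i + 1) : ℕ)) : ZMod ((F.P K).sitesPerDir 0)))
      (fun k => ((((a.src k).val * F.L ^ (j + 1) : ℕ)) : ZMod ((F.P K).sitesPerDir 0))) + 3 * F.L ^ i + 12 ≤
        5 * F.L ^ (j + 1) + 12 * F.L ^ i + 3 * F.L ^ (i + 1)} := by
    show Site.tdist _ _ + 3 * F.L ^ i + 12 ≤ _
    have g3 := tdist_block_le (F := F) hi1 hL3 c.src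
    rw [tdist_comm] at g3
    have g6 := tdist_triangle (fun k => ((((blockOf c.src k).val * F.L ^ (i + 1) : ℕ)) : ZMod ((F.P K).sitesPerDir 0)))
      (fun k => ((((c.src k).val * F.L ^ i : ℕ)) : ZMod ((F.P K).sitesPerDir 0)))
      (fun k => ((((a.src k).val * F.L ^ (j + 1) : ℕ)) : ZMod ((F.P K).sitesPerDir 0)))
    have hLi : 1 ≤ F.L ^ i := Nat.one_le_pow _ _ (by omega)
    omega
  have h2 := hu c hcS
  have e5 : ((((F.P K).d + 2) * (F.P K).L : ℕ) : ℝ) = 5 * (F.L : ℝ) := by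
    show ((((3 + 2) * F.L : ℕ)) : ℝ) = 5 * (F.L : ℝ); push_cast; ring
  have ed : ((F.P K).d : ℝ) = 3 := by rw [hd]; norm_num
  have eL : ((F.P K).L : ℝ) = F.L := rfl
  rw [e5, ed, eL] at h2
  have hwθ : w ≤ 4 * (F.L : ℝ) * θi := by
    rw [hw, hθi]
    have := θBal_pred_le (F := F) (K := K) hL1 hγ hγ1 hb.le hp (i := i) (by omega)
    linarith
  have key := arith_level hX0 hw0 (hθ0 i) hLr hq hwθ
  have e1 : ∑ i' ∈ Finset.Ico (i + 1) j, θBal F.L γ b₀ p₀ (K - i') * ((2 : ℝ) / F.L) ^ (i' - i) =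
      (2 / F.L) * ∑ i' ∈ Finset.Ico (i + 1) j, θBal F.L γ b₀ p₀ (K - i') * ((2 : ℝ) / F.L) ^ (i' - (i + 1)) := by
    rw [Finset.mul_sum]
    refine Finset.sum_congr rfl fun i' hi' => ?_
    have hlt := (Finset.mem_Ico.1 hi').1
    have : i' - i = (i' - (i + 1)) + 1 := by omega
    rw [this, pow_succ]; ring
  have e2 : ((2 : ℝ) / F.L) ^ (j - i) = (2 / F.L) * ((2 : ℝ) / F.L) ^ (j - (i + 1)) := by
    have : j - i = (j - (i + 1)) + 1 := by omega
    rw [this, pow_succ]; ring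
  have hsplit : 72 * (F.L : ℝ) ^ 2 * θi + (2 / F.L) * X =
      72 * (F.L : ℝ) ^ 2 * (∑ i' ∈ Finset.Ico i j, θBal F.L γ b₀ p₀ (K - i') * ((2 : ℝ) / F.L) ^ (i' - i)) +
        6694 * (F.L : ℝ) ^ 2 * θBal F.L γ b₀ p₀ (K - j) * ((2 : ℝ) / F.L) ^ (j - i) := by
    rw [Finset.sum_eq_sum_Ico_succ_bot hij, Nat.sub_self, pow_zero, mul_one, e1, e2, hX, hθi]
    ring
  exact (h2.trans key).trans (le_of_eq hsplit)


/-- ★★ **THE SHARP TOWER (induction)**: from the flat level `j` (✓`exists_hierGauge_dist1_le_of_windows_level`) down to level `i`, on the regions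
`tdist ≤ 5L^{j+1} + 12(L^i − 1)`, `dist1 (((Ū^i U)^u) c) ≤ 72L²·Σ_{i≤i'<j} θBal(K−i')(2∕L)^{i'−i} + 6694L²·θBal(K−j)(2∕L)^{j−i}`. [folklore] -/
theorem exists_hierGauge_sharp_aux (hjK : j + 3 ≤ K) (hγ : 0 < γ) (hγ1 : γ ≤ 1) (hb : 0 < b₀) (hp : 0 ≤ p₀)
    (hθσ : ∀ i, i ≤ j → θBal F.L γ b₀ p₀ (K - i) ≤ 1 / (2 * 10 ^ 7 * (F.L : ℝ) ^ 4))
    (a : Plaq (F.P K) (j + 1)) (U : GaugeField (F.P K) 0 (Matrix.specialUnitaryGroup (Fin 2) ℂ))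
    (hU : (∀ (i : ℕ) (q : Plaq (F.P K) i), i < j + 1 → Site.tdist (fun k => ((((q.src k).val * F.L ^ i : ℕ)) : ZMod ((F.P K).sitesPerDir 0))) (fun k => ((((a.src k).val * F.L ^ (j + 1) : ℕ)) : ZMod ((F.P K).sitesPerDir 0))) + 64 * F.L ^ i ≤ 64 * F.L ^ (j + 1) → GaugeGroup.dist1 (GaugeField.plaqHol (Averaging.iter (fun i' => BlockAveraging.blockAvg (P := F.P K) (j := i') T3UnitLawDensityEML.ℰp) i U) q) < T3UnitScaleTilt.θBal F.L γ b₀ p₀ (K - i))) :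
    ∀ (N i : ℕ), i + N = j →
      ∃ u : GaugeTransf (F.P K) i (Matrix.specialUnitaryGroup (Fin 2) ℂ), ∀ c : PBond (F.P K) i,
        Site.tdist (fun k => ((((c.src k).val * F.L ^ i : ℕ)) : ZMod ((F.P K).sitesPerDir 0)))
            (fun k => ((((a.src k).val * F.L ^ (j + 1) : ℕ)) : ZMod ((F.P K).sitesPerDir 0))) ≤ 5 * F.L ^ (j + 1) + 12 * (F.L ^ i - 1) →
        dist1 (GaugeField.gaugeAct u (Averaging.iter (fun i' => BlockAveraging.blockAvg (P := F.P K) (j := i') T3UnitLawDensityEML.ℰp) i U) c) ≤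
          72 * (F.L : ℝ) ^ 2 * (∑ i' ∈ Finset.Ico i j, θBal F.L γ b₀ p₀ (K - i') * ((2 : ℝ) / F.L) ^ (i' - i)) +
            6694 * (F.L : ℝ) ^ 2 * θBal F.L γ b₀ p₀ (K - j) * ((2 : ℝ) / F.L) ^ (j - i) := by
  have hL3 : 3 ≤ F.L := (by obtain ⟨k, hk⟩ := F.hL.1; have := F.hL.2; omega)
  have hm := F.hm
  have hσ75 : ∀ i, i ≤ j → θBal F.L γ b₀ p₀ (K - i) ≤ 1 / (75 * ((F.L : ℝ) + 1) ^ 2) := fun i hi => (hθσ i hi).trans (by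
    have hLr : (3 : ℝ) ≤ F.L := by exact_mod_cast hL3
    rw [div_le_div_iff₀ (by positivity) (by positivity), one_mul, one_mul]
    have hL2 : (9 : ℝ) ≤ (F.L : ℝ) ^ 2 := by nlinarith
    have h1 : ((F.L : ℝ) + 1) ^ 2 ≤ 4 * (F.L : ℝ) ^ 2 := by nlinarith
    have h4 : (F.L : ℝ) ^ 4 = (F.L : ℝ) ^ 2 * (F.L : ℝ) ^ 2 := by ring
    nlinarith)
  intro N
  induction N with
  | zero =>
    intro i hi
    rw [Nat.add_zero] at hi
    subst hi
    obtain ⟨u, hu⟩ := exists_hierGauge_dist1_le_of_windows_level hjK hγ hγ1 hb hσ75 a U hU i (by omega)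
    refine ⟨u, fun c hc => ?_⟩
    have hreg : 5 * F.L ^ (i + 1) + 12 * (F.L ^ i - 1) ≤ 8 * F.L ^ (i + 1) + 3 * (F.L ^ i - 1) := by
      have : 9 * F.L ^ i ≤ 3 * F.L ^ (i + 1) := by
        rw [pow_succ]
        calc 9 * F.L ^ i = 3 * (F.L ^ i * 3) := by ring
          _ ≤ 3 * (F.L ^ i * F.L) := Nat.mul_le_mul_left _ (Nat.mul_le_mul_left _ hL3)
      omega
    have h1 := hu c (hc.trans hreg)
    rw [Finset.sum_Ico_succ_top (by omega : i ≤ i), Finset.Ico_self, Finset.sum_empty, zero_add] at h1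
    rw [Finset.Ico_self, Finset.sum_empty, mul_zero, zero_add, Nat.sub_self, pow_zero, mul_one]
    linarith
  | succ N ih =>
    intro i hi
    have hij : i < j := by omega
    obtain ⟨h', hh'⟩ := ih (i + 1) (by omega)
    obtain ⟨u, -, hu⟩ := exists_rooted_sharp_step hjK hγ hγ1 hb hp hθσ a U hU hij h' hh'
    exact ⟨u, hu⟩

/-- ★★★ **THE HIERARCHICAL GAUGE WITH GEOMETRIC DECAY, AT EVERY LEVEL** (hStab's windows VERBATIM; `j + 3 ≤ K`, `0 < γ ≤ 1`, `0 < b₀`, `0 ≤ p₀`,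
`θBal(K−i') ≤ 1∕(2·10⁷L⁴)` for `i' ≤ j`): for every height `i ≤ j` (level `j + 1` itself is the flat top of ✓`PoincareLipschitzHierAlignT3Level`) ONE gauge `u` of `T^{(i)}` gives, on every level-`i` bond `c` with
scaled corner within `5L^{j+1} + 12(L^i − 1)` of `a₋·L^{j+1}`,
`dist1 (((Ū^i U)^u) c) ≤ 72L²·Σ_{i≤i'<j+1} θBal(K−i')·(2∕L)^{i'−i} + 3347L³·θBal(K−j)·(2∕L)^{j+1−i}` — ratio `2∕L ≤ 2∕3`. [folklore] -/
theorem exists_hierGauge_dist1_le_of_windows_level_sharp (hjK : j + 3 ≤ K) (hγ : 0 < γ) (hγ1 : γ ≤ 1) (hb : 0 < b₀) (hp : 0 ≤ p₀)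
    (hθσ : ∀ i, i ≤ j → θBal F.L γ b₀ p₀ (K - i) ≤ 1 / (2 * 10 ^ 7 * (F.L : ℝ) ^ 4))
    (a : Plaq (F.P K) (j + 1)) (U : GaugeField (F.P K) 0 (Matrix.specialUnitaryGroup (Fin 2) ℂ))
    (hU : (∀ (i : ℕ) (q : Plaq (F.P K) i), i < j + 1 → Site.tdist (fun k => ((((q.src k).val * F.L ^ i : ℕ)) : ZMod ((F.P K).sitesPerDir 0))) (fun k => ((((a.src k).val * F.L ^ (j + 1) : ℕ)) : ZMod ((F.P K).sitesPerDir 0))) + 64 * F.L ^ i ≤ 64 * F.L ^ (j + 1) → GaugeGroup.dist1 (GaugeField.plaqHol (Averaging.iter (fun i' => BlockAveraging.blockAvg (P := F.P K) (j := i') T3UnitLawDensityEML.ℰp) i U) q) < T3UnitScaleTilt.θBal F.L γ b₀ p₀ (K - i)))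
    (i : ℕ) (hi : i ≤ j) :
    ∃ u : GaugeTransf (F.P K) i (Matrix.specialUnitaryGroup (Fin 2) ℂ), ∀ c : PBond (F.P K) i,
      Site.tdist (fun k => ((((c.src k).val * F.L ^ i : ℕ)) : ZMod ((F.P K).sitesPerDir 0)))
          (fun k => ((((a.src k).val * F.L ^ (j + 1) : ℕ)) : ZMod ((F.P K).sitesPerDir 0))) ≤ 5 * F.L ^ (j + 1) + 12 * (F.L ^ i - 1) →
      dist1 (GaugeField.gaugeAct u (Averaging.iter (fun i' => BlockAveraging.blockAvg (P := F.P K) (j := i') T3UnitLawDensityEML.ℰp) i U) c) ≤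
        72 * (F.L : ℝ) ^ 2 * (∑ i' ∈ Finset.Ico i (j + 1), θBal F.L γ b₀ p₀ (K - i') * ((2 : ℝ) / F.L) ^ (i' - i)) +
          3347 * (F.L : ℝ) ^ 3 * θBal F.L γ b₀ p₀ (K - j) * ((2 : ℝ) / F.L) ^ (j + 1 - i) := by
  have hL3 : 3 ≤ F.L := (by obtain ⟨k, hk⟩ := F.hL.1; have := F.hL.2; omega)
  have hLr : (3 : ℝ) ≤ F.L := by exact_mod_cast hL3
  have hL0 : (0 : ℝ) < F.L := by linarith
  have hθ0 : ∀ i, 0 ≤ θBal F.L γ b₀ p₀ (K - i) := fun i =>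
    (T3MinimiserStabilityReduction.θBal_pos (by omega) hγ hγ1 hb p₀ (K - i)).le
  have hr0 : (0 : ℝ) ≤ 2 / F.L := by positivity
  have hσ75 : ∀ i, i ≤ j → θBal F.L γ b₀ p₀ (K - i) ≤ 1 / (75 * ((F.L : ℝ) + 1) ^ 2) := fun i hi => (hθσ i hi).trans (by
    rw [div_le_div_iff₀ (by positivity) (by positivity), one_mul, one_mul]
    have hL2 : (9 : ℝ) ≤ (F.L : ℝ) ^ 2 := by nlinarith
    have h1 : ((F.L : ℝ) + 1) ^ 2 ≤ 4 * (F.L : ℝ) ^ 2 := by nlinarith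
    have h4 : (F.L : ℝ) ^ 4 = (F.L : ℝ) ^ 2 * (F.L : ℝ) ^ 2 := by ring
    nlinarith)
  obtain ⟨u, hu⟩ := exists_hierGauge_sharp_aux hjK hγ hγ1 hb hp hθσ a U hU (j - i) i (by omega)
  refine ⟨u, fun c hc => (hu c hc).trans ?_⟩
  rw [Finset.sum_Ico_succ_top (by omega : i ≤ j)]
  have hlast : 0 ≤ θBal F.L γ b₀ p₀ (K - j) * ((2 : ℝ) / F.L) ^ (j - i) := mul_nonneg (hθ0 j) (pow_nonneg hr0 _)
  have e : ((2 : ℝ) / F.L) ^ (j + 1 - i) = (2 / F.L) * ((2 : ℝ) / F.L) ^ (j - i) := by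
    have : j + 1 - i = (j - i) + 1 := by omega
    rw [this, pow_succ]; ring
  rw [e]
  have e2 : 3347 * (F.L : ℝ) ^ 3 * θBal F.L γ b₀ p₀ (K - j) * ((2 / F.L) * ((2 : ℝ) / F.L) ^ (j - i)) =
      6694 * (F.L : ℝ) ^ 2 * θBal F.L γ b₀ p₀ (K - j) * ((2 : ℝ) / F.L) ^ (j - i) := by
    field_simp; ring
  rw [e2]
  nlinarith [sq_nonneg (F.L : ℝ)]

/-- ★★ **THE TWO-FIELD SUP-CHART WITH GEOMETRIC DECAY**: under the same hypotheses for two configurations `U, U'`, for every height `i ≤ j` ONE gauge `g`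
of `T^{(i)}` gives `dist1 (((Ū^i U')^g) c · ((Ū^i U) c)⁻¹) ≤ 2·(72L²·Σ_{i≤i'<j+1} θBal(K−i')(2∕L)^{i'−i} + 3347L³·θBal(K−j)(2∕L)^{j+1−i})` on the
level-`i` region `5L^{j+1} + 12(L^i − 1)` (✓`PoincareLipschitzHierAlignTower.dist1_relGauge_le`). [folklore] -/
theorem exists_relGauge_dist1_le_of_windows_level_sharp (hjK : j + 3 ≤ K) (hγ : 0 < γ) (hγ1 : γ ≤ 1) (hb : 0 < b₀) (hp : 0 ≤ p₀)
    (hθσ : ∀ i, i ≤ j → θBal F.L γ b₀ p₀ (K - i) ≤ 1 / (2 * 10 ^ 7 * (F.L : ℝ) ^ 4))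
    (a : Plaq (F.P K) (j + 1)) (U U' : GaugeField (F.P K) 0 (Matrix.specialUnitaryGroup (Fin 2) ℂ))
    (hU : (∀ (i : ℕ) (q : Plaq (F.P K) i), i < j + 1 → Site.tdist (fun k => ((((q.src k).val * F.L ^ i : ℕ)) : ZMod ((F.P K).sitesPerDir 0))) (fun k => ((((a.src k).val * F.L ^ (j + 1) : ℕ)) : ZMod ((F.P K).sitesPerDir 0))) + 64 * F.L ^ i ≤ 64 * F.L ^ (j + 1) → GaugeGroup.dist1 (GaugeField.plaqHol (Averaging.iter (fun i' => BlockAveraging.blockAvg (P := F.P K) (j := i') T3UnitLawDensityEML.ℰp) i U) q) < T3UnitScaleTilt.θBal F.L γ b₀ p₀ (K - i)))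
    (hU' : (∀ (i : ℕ) (q : Plaq (F.P K) i), i < j + 1 → Site.tdist (fun k => ((((q.src k).val * F.L ^ i : ℕ)) : ZMod ((F.P K).sitesPerDir 0))) (fun k => ((((a.src k).val * F.L ^ (j + 1) : ℕ)) : ZMod ((F.P K).sitesPerDir 0))) + 64 * F.L ^ i ≤ 64 * F.L ^ (j + 1) → GaugeGroup.dist1 (GaugeField.plaqHol (Averaging.iter (fun i' => BlockAveraging.blockAvg (P := F.P K) (j := i') T3UnitLawDensityEML.ℰp) i U') q) < T3UnitScaleTilt.θBal F.L γ b₀ p₀ (K - i)))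
    (i : ℕ) (hi : i ≤ j) :
    ∃ g : GaugeTransf (F.P K) i (Matrix.specialUnitaryGroup (Fin 2) ℂ), ∀ c : PBond (F.P K) i,
      Site.tdist (fun k => ((((c.src k).val * F.L ^ i : ℕ)) : ZMod ((F.P K).sitesPerDir 0)))
          (fun k => ((((a.src k).val * F.L ^ (j + 1) : ℕ)) : ZMod ((F.P K).sitesPerDir 0))) ≤ 5 * F.L ^ (j + 1) + 12 * (F.L ^ i - 1) →
      dist1 (GaugeField.gaugeAct g (Averaging.iter (fun i' => BlockAveraging.blockAvg (P := F.P K) (j := i') T3UnitLawDensityEML.ℰp) i U') c *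
          (Averaging.iter (fun i' => BlockAveraging.blockAvg (P := F.P K) (j := i') T3UnitLawDensityEML.ℰp) i U c)⁻¹) ≤
        2 * (72 * (F.L : ℝ) ^ 2 * (∑ i' ∈ Finset.Ico i (j + 1), θBal F.L γ b₀ p₀ (K - i') * ((2 : ℝ) / F.L) ^ (i' - i)) +
          3347 * (F.L : ℝ) ^ 3 * θBal F.L γ b₀ p₀ (K - j) * ((2 : ℝ) / F.L) ^ (j + 1 - i)) := by
  obtain ⟨u, hu⟩ := exists_hierGauge_dist1_le_of_windows_level_sharp hjK hγ hγ1 hb hp hθσ a U hU i hi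
  obtain ⟨u', hu'⟩ := exists_hierGauge_dist1_le_of_windows_level_sharp hjK hγ hγ1 hb hp hθσ a U' hU' i hi
  refine ⟨fun x => (u x)⁻¹ * u' x, fun c hc => ?_⟩
  have h := dist1_relGauge_le _ _ u u' c (hu c hc) (hu' c hc)
  linarith

end Summit.QuantumFields.YangMills.Theorems.PoincareLipschitzHierAlignT3Sharp

end
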